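/-
Copyright (c) 2026 the pub-hodgecm-mathlib formalisation cell (harness21).  Prover seat hodgecm-mathlib-K2E3-p21 (g2), HCML Track B «K2-LIT» (build stream 29),
h413 = `stmt-HodgeConjecture-24833`, line `K2_E3_EllipticInputs`, unit U3, line U3-d (lead K2E3-p03 (g0)), FILE C: TRANSPORT OF THE SCALING DATA (i)+(ii) ALONG AN
ISOMORPHISM OF TOPOLOGICAL GROUPS (model `U(σ_w, J₀)(L_w)` → `Gqs L v` along `e = localNonsplitEquiv`).  Offer `K2/STATUS.md` 2026-09-03T23:23:33Z.  2026-09-03.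
-/
import Literature.NumberTheory.Automorphic.UnitaryGroupRestrictedProduct   -- ★ `ContinuousMulEquiv.restrictSubgroup` (+ `coe_restrictSubgroup(_symm)_apply`)
import Mathlib.MeasureTheory.Group.Measure
import HarnessLib

/-!
# h413 ∕ Track B «K2-LIT», line U3-d, FILE C: TRANSPORT OF THE UNIPOTENT SCALING DATA `(h, K, ρ)` ALONG `e : G ≃ₜ* M`

Cell `pub/hodgecm-mathlib`, crux H413 = `stmt-HodgeConjecture-24833`, route of record `HCCMUnconditional`; chair K2-lead (g0), dealer K2E3-plan (g1), line lead of U3-d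
K2E3-p03 (g0).  THEOREMS ONLY (no `def`, no `instance`, no `notation`, no named-fact hypothesis, no `sorry`); imports = ★ + Mathlib + HarnessLib; lane
`--supports stmt-HodgeConjecture-24833 --as helper` (count-neutral).  Companion of ★ p855528 `K2E3UnipotentAdaptedFrame` and ★ p855586 `K2E3LocalLatticeScalingIndex`.

WHAT THIS FILE DOES.  Rungs C1∕C2 of FILE C prove the hypotheses (i)+(ii) of ★ p855453 §1
(`K2E3UnipotentOrbitalScalingOfIndex.integral_descConj_indicator_comp_eq_smul_of_conj_of_index`) in the MODEL `M = U(σ_w, J₀)(L_w)` at `e u₀`; the assembly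
(`K2E3UnipotentOrbitalScalingLaw`, K2E3-p03) needs them in `G = Gqs L v` at `u₀`, `e = localNonsplitEquiv : G ≃ₜ* M`.  Here, for ANY isomorphism of topological groups
`e : G ≃ₜ* M` and any self-map `Ψ : G → G`, element `u₀ : G`:
* §1 `hΨ` and `hZ` transport: `e (Ψ u₀) = h'·e u₀·h'⁻¹ ⟹ Ψ u₀ = h u₀ h⁻¹` with `h = e⁻¹ h'` (`conj_eq_of_map_conj_eq`); `z ∈ Z(u₀) ⟺ e z ∈ Z(e u₀)`
  (`mem_centralizer_iff_map_mem`); the normalising letter `hZ'` at `e u₀` gives `hZ` at `u₀` (`forall_mem_centralizer_iff_of_map`).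
* §2 subgroups: `K := K'.comap e` is compact open when `K'` is (`isOpen_coe_comap`, `isCompact_coe_comap`), and `(K'.comap e).map (conj h) = (K'.map (conj h')).comap e`
  (`map_conj_comap_eq_comap_map_conj`).
* §3 measures: with `eZ : ↥Z(u₀) ≃ₜ* ↥Z(e u₀)` the restriction of `e` (★ `ContinuousMulEquiv.restrictSubgroup`), `ρ := map eZ⁻¹ ρ'` is left-invariant, finite on compacts and
  positive on opens when `ρ'` is, and `ρ(Z(u₀) ∩ K'.comap e … ) = ρ'(Z(e u₀) ∩ K' …)` on the two sets of the `hr` letter (`map_restrict_symm_apply_preimage_comap`).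
* §4 HEAD `exists_scalingData_of_continuousMulEquiv`: from the §1-letters of ★ p855453 at `e u₀` in `M` (`hΨ' hZ' K' hK'o hK'c ρ' + instances + hr'`) produce `h K ρ` with
  EXACTLY the §1-letters at `u₀` in `G` and the same constant `r`.
Pure topological-group ∕ measure bookkeeping (Mathlib `isMulLeftInvariant_map`, `IsFiniteMeasureOnCompacts.map`, `Continuous.isOpenPosMeasure_map`, `MeasurableEquiv.map_apply`).

HONEST LABEL.  HC_CM is proved only modulo the 7 printed citations (2 remaining named inputs: hLiu418 = `stmt-HodgeConjecture-24832`, h413 =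
`stmt-HodgeConjecture-24833`) until rung 0 closes; count-neutral helper.

## References
* [DeitmarEchterhoff2014] A. Deitmar, S. Echterhoff, *Principles of Harmonic Analysis*, 2nd ed. (2014), Thm. 1.5.3 and §1.5 (transport of Haar measures along isomorphisms).
* [HarishChandra1999AdmissibleDistributions] Harish-Chandra, *Admissible Invariant Distributions on Reductive p-adic Groups*, ULS 16 (1999), §3.1 Lemma 3.2.
* [PlatonovRapinchuk1994] V. Platonov, A. Rapinchuk, *Algebraic Groups and Number Theory* (1994), §5.1 (the one-place model at a non-split place).
-/

set_option autoImplicit false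
set_option linter.dupNamespace false  -- the mandated namespace repeats the single-problem summit's segment (`HodgeConjecture.HodgeConjecture`)

noncomputable section

open MeasureTheory Topology Literature.NumberTheory.Automorphic
open scoped ENNReal NNReal

namespace Summit.HodgeConjecture.HodgeConjecture.Cruxes.H413.K2E3OrbitalScalingDataTransport

variable {G M : Type*} [Group G] [Group M] [TopologicalSpace G] [TopologicalSpace M]

/-! ## §1 `hΨ` and `hZ` along `e` -/

/-- **`e (Ψ u₀) = h'·(e u₀)·h'⁻¹ ⟹ Ψ u₀ = (e⁻¹h')·u₀·(e⁻¹h')⁻¹`.** [cite: PlatonovRapinchuk1994, §5.1] -/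
theorem conj_eq_of_map_conj_eq (e : G ≃ₜ* M) {Ψ : G → G} {u₀ : G} {h' : M} (hΨ' : e (Ψ u₀) = h' * e u₀ * h'⁻¹) :
    Ψ u₀ = e.symm h' * u₀ * (e.symm h')⁻¹ :=
  e.injective (by rw [hΨ', map_mul, map_mul, map_inv, ContinuousMulEquiv.apply_symm_apply])

/-- **`z ∈ Z(u₀) ⟺ e z ∈ Z(e u₀)`.** [cite: PlatonovRapinchuk1994, §5.1] -/
theorem mem_centralizer_iff_map_mem (e : G ≃ₜ* M) (u₀ z : G) :
    z ∈ Subgroup.centralizer ({u₀} : Set G) ↔ e z ∈ Subgroup.centralizer ({e u₀} : Set M) := by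
  rw [Subgroup.mem_centralizer_singleton_iff, Subgroup.mem_centralizer_singleton_iff, ← map_mul, ← map_mul, e.injective.eq_iff]

/-- **The `hZ` letter transports**: if `h'` normalises `Z(e u₀)` then `e⁻¹ h'` normalises `Z(u₀)`. [cite: PlatonovRapinchuk1994, §5.1] -/
theorem forall_mem_centralizer_iff_of_map (e : G ≃ₜ* M) (u₀ : G) {h' : M}
    (hZ' : ∀ z' : M, z' ∈ Subgroup.centralizer ({e u₀} : Set M) ↔ h' * z' * h'⁻¹ ∈ Subgroup.centralizer ({e u₀} : Set M)) (z : G) :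
    z ∈ Subgroup.centralizer ({u₀} : Set G) ↔ e.symm h' * z * (e.symm h')⁻¹ ∈ Subgroup.centralizer ({u₀} : Set G) := by
  rw [mem_centralizer_iff_map_mem e u₀ z, mem_centralizer_iff_map_mem e u₀, map_mul, map_mul, map_inv, ContinuousMulEquiv.apply_symm_apply]
  exact hZ' (e z)

/-! ## §2 Subgroups along `e` -/

/-- `K'.comap e` is open when `K'` is. [cite: DeitmarEchterhoff2014, §1.5] -/
theorem isOpen_coe_comap (e : G ≃ₜ* M) {K' : Subgroup M} (hK'o : IsOpen (K' : Set M)) :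
    IsOpen ((K'.comap e.toMulEquiv.toMonoidHom : Subgroup G) : Set G) := by
  rw [Subgroup.coe_comap]
  exact hK'o.preimage e.continuous

/-- `K'.comap e` is compact when `K'` is (`e` is a homeomorphism). [cite: DeitmarEchterhoff2014, §1.5] -/
theorem isCompact_coe_comap (e : G ≃ₜ* M) {K' : Subgroup M} (hK'c : IsCompact (K' : Set M)) :
    IsCompact ((K'.comap e.toMulEquiv.toMonoidHom : Subgroup G) : Set G) := by
  rw [Subgroup.coe_comap]
  exact (e : G ≃ₜ M).isCompact_preimage.2 hK'c

/-- **`(K'.comap e).map (conj (e⁻¹h')) = (K'.map (conj h')).comap e`.** [folklore] -/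
theorem map_conj_comap_eq_comap_map_conj (e : G ≃ₜ* M) (K' : Subgroup M) (h' : M) :
    (K'.comap e.toMulEquiv.toMonoidHom).map (MulAut.conj (e.symm h')).toMonoidHom =
      (K'.map (MulAut.conj h').toMonoidHom).comap e.toMulEquiv.toMonoidHom := by
  ext x
  rw [Subgroup.mem_map, Subgroup.mem_comap, Subgroup.mem_map]
  constructor
  · rintro ⟨y, hy, rfl⟩
    rw [Subgroup.mem_comap] at hy
    refine ⟨e y, hy, ?_⟩
    show h' * e y * h'⁻¹ = e (e.symm h' * y * (e.symm h')⁻¹)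
    rw [map_mul, map_mul, map_inv, ContinuousMulEquiv.apply_symm_apply]
  · rintro ⟨y', hy', hx⟩
    refine ⟨e.symm y', ?_, ?_⟩
    · show e (e.symm y') ∈ K'
      rw [ContinuousMulEquiv.apply_symm_apply]; exact hy'
    · apply e.injective
      show e (e.symm h' * e.symm y' * (e.symm h')⁻¹) = e x
      rw [map_mul, map_mul, map_inv, ContinuousMulEquiv.apply_symm_apply, ContinuousMulEquiv.apply_symm_apply]
      exact hx

/-! ## §3 Measures on the centralisers along the restriction `eZ : ↥Z(u₀) ≃ₜ* ↥Z(e u₀)` -/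

section Measure

variable [IsTopologicalGroup G] [IsTopologicalGroup M] [MeasurableSpace G] [BorelSpace G] [MeasurableSpace M] [BorelSpace M]

omit [IsTopologicalGroup G] [IsTopologicalGroup M] [MeasurableSpace G] [BorelSpace G] [MeasurableSpace M] [BorelSpace M] in
/-- The set `Z(u₀) ∩ e⁻¹(S)` read on `↥Z(e u₀)`: `eZ.symm ⁻¹' (val⁻¹' (e⁻¹ S)) = val⁻¹' S`. [folklore] -/
theorem restrict_symm_preimage_preimage_comap (e : G ≃ₜ* M) (u₀ : G) (S : Set M) :
    (ContinuousMulEquiv.restrictSubgroup e (Subgroup.centralizer ({u₀} : Set G)) (Subgroup.centralizer ({e u₀} : Set M))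
        (mem_centralizer_iff_map_mem e u₀)).symm ⁻¹' (Subtype.val ⁻¹' (e ⁻¹' S)) = Subtype.val ⁻¹' S := by
  ext z'
  simp only [Set.mem_preimage, ContinuousMulEquiv.coe_restrictSubgroup_symm_apply, ContinuousMulEquiv.apply_symm_apply]

/-- **Transport of the centraliser measure**: for `ρ'` on `↥Z(e u₀)` left-invariant, finite on compacts, positive on opens, the push-forward `ρ := map eZ⁻¹ ρ'` on `↥Z(u₀)` has
the same three properties, and `ρ(val⁻¹'(e⁻¹ S)) = ρ'(val⁻¹' S)` for every `S ⊆ M`. [cite: DeitmarEchterhoff2014, §1.5] -/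
theorem map_restrict_symm_props (e : G ≃ₜ* M) (u₀ : G) (ρ' : Measure ↥(Subgroup.centralizer ({e u₀} : Set M)))
    [ρ'.IsMulLeftInvariant] [IsFiniteMeasureOnCompacts ρ'] [ρ'.IsOpenPosMeasure] :
    (Measure.map ((ContinuousMulEquiv.restrictSubgroup e (Subgroup.centralizer ({u₀} : Set G)) (Subgroup.centralizer ({e u₀} : Set M))
        (mem_centralizer_iff_map_mem e u₀)).symm) ρ').IsMulLeftInvariant ∧
    IsFiniteMeasureOnCompacts (Measure.map ((ContinuousMulEquiv.restrictSubgroup e (Subgroup.centralizer ({u₀} : Set G))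
        (Subgroup.centralizer ({e u₀} : Set M)) (mem_centralizer_iff_map_mem e u₀)).symm) ρ') ∧
    (Measure.map ((ContinuousMulEquiv.restrictSubgroup e (Subgroup.centralizer ({u₀} : Set G)) (Subgroup.centralizer ({e u₀} : Set M))
        (mem_centralizer_iff_map_mem e u₀)).symm) ρ').IsOpenPosMeasure ∧
    ∀ S : Set M, (Measure.map ((ContinuousMulEquiv.restrictSubgroup e (Subgroup.centralizer ({u₀} : Set G)) (Subgroup.centralizer ({e u₀} : Set M))
        (mem_centralizer_iff_map_mem e u₀)).symm) ρ') (Subtype.val ⁻¹' (e ⁻¹' S)) = ρ' (Subtype.val ⁻¹' S) := by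
  set eZ := ContinuousMulEquiv.restrictSubgroup e (Subgroup.centralizer ({u₀} : Set G)) (Subgroup.centralizer ({e u₀} : Set M))
    (mem_centralizer_iff_map_mem e u₀) with heZ
  refine ⟨?_, ?_, ?_, fun S => ?_⟩
  · exact isMulLeftInvariant_map eZ.symm.toMulEquiv.toMulHom eZ.symm.continuous.measurable eZ.symm.surjective
  · exact Measure.IsFiniteMeasureOnCompacts.map ρ' (eZ.symm : ↥(Subgroup.centralizer ({e u₀} : Set M)) ≃ₜ ↥(Subgroup.centralizer ({u₀} : Set G)))
  · exact eZ.symm.continuous.isOpenPosMeasure_map eZ.symm.surjective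
  · have hme : MeasurableEmbedding (eZ.symm : ↥(Subgroup.centralizer ({e u₀} : Set M)) → ↥(Subgroup.centralizer ({u₀} : Set G))) :=
      (eZ.symm : ↥(Subgroup.centralizer ({e u₀} : Set M)) ≃ₜ ↥(Subgroup.centralizer ({u₀} : Set G))).measurableEmbedding
    rw [hme.map_apply]
    exact congrArg ρ' (restrict_symm_preimage_preimage_comap e u₀ S)

end Measure

/-! ## §4 The head: the (i)+(ii) data of ★ p855453 §1 transport along `e` -/

/-- **TRANSPORT OF THE SCALING DATA ALONG `e : G ≃ₜ* M`.**  Given, at `e u₀` in `M`, the letters of ★ p855453 §1 — `hΨ' : e (Ψ u₀) = h'·e u₀·h'⁻¹`, `hZ'` (`h'`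
normalises `Z(e u₀)`), a compact open subgroup `K'`, a left-invariant measure `ρ'` on `↥Z(e u₀)` finite on compacts and positive on opens, and the index identity
`r·ρ'(Z ∩ h'K'h'⁻¹) = ρ'(Z ∩ K')` — there are `h`, `K`, `ρ` at `u₀` in `G` with the SAME letters and the same `r` (`h = e⁻¹h'`, `K = e⁻¹K'`, `ρ = (e|_Z)⁻¹_* ρ'`).  With
`G = Gqs L v`, `M = U(σ_w, J₀)(L_w)`, `e = localNonsplitEquiv`: rungs C1∕C2 (model) ⟹ the hypotheses of ★ p855453 at `Gqs L v`.
[cite: DeitmarEchterhoff2014, Thm. 1.5.3] [cite: HarishChandra1999AdmissibleDistributions, §3.1 Lemma 3.2] [cite: PlatonovRapinchuk1994, §5.1] -/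
theorem exists_scalingData_of_continuousMulEquiv [IsTopologicalGroup G] [IsTopologicalGroup M] [MeasurableSpace G] [BorelSpace G]
    [MeasurableSpace M] [BorelSpace M] (e : G ≃ₜ* M) (Ψ : G → G) (u₀ : G) {h' : M}
    (hΨ' : e (Ψ u₀) = h' * e u₀ * h'⁻¹)
    (hZ' : ∀ z' : M, z' ∈ Subgroup.centralizer ({e u₀} : Set M) ↔ h' * z' * h'⁻¹ ∈ Subgroup.centralizer ({e u₀} : Set M))
    (K' : Subgroup M) (hK'o : IsOpen (K' : Set M)) (hK'c : IsCompact (K' : Set M))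
    (ρ' : Measure ↥(Subgroup.centralizer ({e u₀} : Set M))) [ρ'.IsMulLeftInvariant] [IsFiniteMeasureOnCompacts ρ'] [ρ'.IsOpenPosMeasure]
    {r : ℝ≥0} (hr' : (r : ℝ≥0∞) * ρ' (Subtype.val ⁻¹' ((K'.map (MulAut.conj h').toMonoidHom : Subgroup M) : Set M)) = ρ' (Subtype.val ⁻¹' (K' : Set M))) :
    ∃ (h : G) (K : Subgroup G) (ρ : Measure ↥(Subgroup.centralizer ({u₀} : Set G))),
      Ψ u₀ = h * u₀ * h⁻¹ ∧
      (∀ z : G, z ∈ Subgroup.centralizer ({u₀} : Set G) ↔ h * z * h⁻¹ ∈ Subgroup.centralizer ({u₀} : Set G)) ∧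
      IsOpen (K : Set G) ∧ IsCompact (K : Set G) ∧
      ρ.IsMulLeftInvariant ∧ IsFiniteMeasureOnCompacts ρ ∧ ρ.IsOpenPosMeasure ∧
      (r : ℝ≥0∞) * ρ (Subtype.val ⁻¹' ((K.map (MulAut.conj h).toMonoidHom : Subgroup G) : Set G)) = ρ (Subtype.val ⁻¹' (K : Set G)) := by
  obtain ⟨hinv, hfin, hpos, hval⟩ := map_restrict_symm_props e u₀ ρ'
  refine ⟨e.symm h', K'.comap e.toMulEquiv.toMonoidHom, _, conj_eq_of_map_conj_eq e hΨ', forall_mem_centralizer_iff_of_map e u₀ hZ',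
    isOpen_coe_comap e hK'o, isCompact_coe_comap e hK'c, hinv, hfin, hpos, ?_⟩
  have h1 : (((K'.comap e.toMulEquiv.toMonoidHom).map (MulAut.conj (e.symm h')).toMonoidHom : Subgroup G) : Set G) =
      e ⁻¹' ((K'.map (MulAut.conj h').toMonoidHom : Subgroup M) : Set M) := by
    rw [map_conj_comap_eq_comap_map_conj, Subgroup.coe_comap]; rfl
  have h2 : ((K'.comap e.toMulEquiv.toMonoidHom : Subgroup G) : Set G) = e ⁻¹' (K' : Set M) := by
    rw [Subgroup.coe_comap]; rfl
  rw [h1, h2, hval, hval, hr']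

end Summit.HodgeConjecture.HodgeConjecture.Cruxes.H413.K2E3OrbitalScalingDataTransport

end
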